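import Mathlib
import HarnessLib

/-!
# The single-visibility block XOR game on `S₃` — definitions, the MERGING identity, MONOTONICITY
# `V_{m+2} ≤ V_{m+1}`, and CONJECTURE F ⇐ its `m = 4` instance

Planner qa-qnc0-p1 g17/g18 (ROUND-16 §10, ROUND-17 §1–§2; sources `HOME/qa-qnc0-p1/exp17b/BlockGame.lean` and
`exp18/Sketch18.lean` §2, definitions VERBATIM — except that `Valid` is an `abbrev` instead of a `def` + `Decidable`
instance, same term), ask P-17a.  This is the finite model behind the dense residual of route `DWalkThree`
(crux `RingDenseResidualLt3`, stmt-QuantumAdvantage-22907) and the last step of the planned local law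
`RingLocalTwoThirds3` (ROUND-17 §4).

THE GAME (`m` blocks).  Outcomes: residues `d : Fin m → ZMod 3` and block transports `π : Fin m → Equiv.Perm (ZMod 3)`
with `π b (d b) = d (b+1)` (indices mod `m`) and `∏ sign (π b) = -1` (`total m = 3^m · 2^(m-1)` outcomes).  Player `b`
sees ONLY `π b` and names a test in `V₄ = {1, φ₀, φ₁, φ₂}` (`φ_r d = 1` if `d = r`, else `-1`); the team WINS iff
`∏_b τ_b(π_b)(d_b) = -1` (equivalently: an odd number of guesses `φ_r` are wrong).  `BlockGameTwoThirds m`: no table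
profile wins more than `2/3` of the outcomes.  Kit j291830/j292729 (exact): `V₁ = 1`, `V₂ = 8/9`, `V₃ = 20/27`,
`V₄ = 2/3`; CONJECTURE F: the law holds for every `m ≥ 4`.

PROVED HERE (0 sorry): `testVal_mulTest`, `testVal_transportTest` (`V₄ ≅ (ℤ/2)²` is closed under products and
transport); **`wins_succ_eq_sum_merge`** (was STUB): `wins (m+2) τ = ∑ g, wins (m+1) (mergeTab g τ)` — merge players
`0, 1` into ONE coarse player who sees only `π₁π₀` and holds `π₀ = g` as a private coin; the bijection
`(d, π) ↦ (π 0; (d 0, d 2, …), (π₁π₀, π₂, …))` (`mergeD`/`mergeP`, inverse `splitD`/`splitP`) preserves admissibility and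
sign and carries the payoff (product + transport laws); **`total_succ`** (was STUB); **`blockGameTwoThirds_succ`**
(MONOTONICITY `V_{m+2} ≤ V_{m+1}`); **`conjectureF'_of_four` / `conjectureF_of_four`** (CONJECTURE F for all `m ≥ 4`
from `BlockGameTwoThirds 4`, whose kernel certificate is ask P-17b and is NOT proved here).
WHAT THIS IS NOT: `BlockGameTwoThirds 4` is not proved here; no ring-side statement (`RingLocalTwoThirds3` = P-17c);
rung F-Q2-odd (`p = 3`) instrument; separation NOT moved.
-/

namespace Summit.QuantumAdvantage.AdviceFreeQNC0.BlockGame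

open Finset Equiv

/-! ## §1 Definitions (qa-qnc0-p1 g17 `exp17b/BlockGame.lean`, verbatim) -/

/-- value of test `t : Fin 4` (`0 = 1`, `r+1 = φ_r`) at residue `d`, as an integer `±1`. -/
def testVal (t : Fin 4) (d : ZMod 3) : ℤ :=
  if t = 0 then 1 else if (d : ZMod 3) = ((t.val - 1 : ℕ) : ZMod 3) then 1 else -1

/-- admissible outcomes: consecutive residues linked by the visible transports, odd total sign.
(`abbrev` so that the filters below find their `Decidable` instances by unfolding; the term is the planner's verbatim.) -/
abbrev Valid (m : ℕ) [NeZero m] (d : Fin m → ZMod 3) (π : Fin m → Equiv.Perm (ZMod 3)) : Prop :=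
  (∀ b : Fin m, π b (d b) = d (b + 1)) ∧ (∏ b : Fin m, (Equiv.Perm.sign (π b) : ℤˣ)) = -1

/-- the team's payoff sign for table profile `τ`. -/
def payoff (m : ℕ) (τ : Fin m → Equiv.Perm (ZMod 3) → Fin 4)
    (d : Fin m → ZMod 3) (π : Fin m → Equiv.Perm (ZMod 3)) : ℤ :=
  ∏ b : Fin m, testVal (τ b (π b)) (d b)

/-- number of admissible outcomes won by `τ`. -/
def wins (m : ℕ) [NeZero m] (τ : Fin m → Equiv.Perm (ZMod 3) → Fin 4) : ℕ :=
  (Finset.univ.filter fun o : (Fin m → ZMod 3) × (Fin m → Equiv.Perm (ZMod 3)) =>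
      Valid m o.1 o.2 ∧ payoff m τ o.1 o.2 = -1).card

/-- number of admissible outcomes (`= 3^m 2^(m-1)`). -/
def total (m : ℕ) [NeZero m] : ℕ :=
  (Finset.univ.filter fun o : (Fin m → ZMod 3) × (Fin m → Equiv.Perm (ZMod 3)) => Valid m o.1 o.2).card

/-- **Block-game two-thirds law** at `m` blocks (single-block visibility): every table profile wins at most
`2/3` of the admissible outcomes.  False for `m ≤ 3`; CONJECTURE F: true for every `m ≥ 4`. -/
def BlockGameTwoThirds (m : ℕ) [NeZero m] : Prop :=
  ∀ τ : Fin m → Equiv.Perm (ZMod 3) → Fin 4, 3 * wins m τ ≤ 2 * total m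

/-- CONJECTURE F (single visibility). -/
def ConjectureF : Prop := ∀ m : ℕ, (h : 4 ≤ m) → @BlockGameTwoThirds m ⟨by omega⟩

/-- CONJECTURE F restated without `NeZero` plumbing: the law at `k + 4` blocks for every `k`. -/
def ConjectureF' : Prop := ∀ k : ℕ, BlockGameTwoThirds (k + 4)

/-! ## §2 `V₄ ≅ (ℤ/2)²`: product and transport of tests (qa-qnc0-p1 g18 `Sketch18.lean` §2a, verbatim) -/

/-- product of tests: `0 = 1`, `φ_r² = 1`, `φ_r φ_s = φ_t` (`{r,s,t} = ℤ/3`). -/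
def mulTest (a b : Fin 4) : Fin 4 :=
  (![![0, 1, 2, 3], ![1, 0, 3, 2], ![2, 3, 0, 1], ![3, 2, 1, 0]] : Fin 4 → Fin 4 → Fin 4) a b

/-- transport of a test along `g`: `(transportTest g t) d = t (g d)`, i.e. `φ_r ∘ g = φ_{g⁻¹ r}`. -/
def transportTest (g : Equiv.Perm (ZMod 3)) (t : Fin 4) : Fin 4 :=
  if t = 0 then 0 else ⟨(g.symm (((t.val - 1 : ℕ) : ZMod 3))).val + 1, by
    have := ZMod.val_lt (g.symm (((t.val - 1 : ℕ) : ZMod 3))); omega⟩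

/-- the PRODUCT LAW: `testVal` is multiplicative along `mulTest`. -/
theorem testVal_mulTest (a b : Fin 4) (d : ZMod 3) :
    testVal (mulTest a b) d = testVal a d * testVal b d := by
  revert a b d; decide

/-- the TRANSPORT LAW: `(transportTest g t) d = t (g d)`. -/
theorem testVal_transportTest (g : Equiv.Perm (ZMod 3)) (t : Fin 4) (d : ZMod 3) :
    testVal (transportTest g t) d = testVal t (g d) := by
  unfold transportTest testVal
  by_cases ht : t = 0
  · simp [ht]
  · have hne : (⟨(g.symm (((t.val - 1 : ℕ) : ZMod 3))).val + 1, by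
        have := ZMod.val_lt (g.symm (((t.val - 1 : ℕ) : ZMod 3))); omega⟩ : Fin 4) ≠ 0 := by
      intro h
      have := congrArg Fin.val h
      simp at this
    rw [if_neg ht, if_neg hne, if_neg ht]
    simp only [Nat.add_sub_cancel, ZMod.natCast_val, ZMod.cast_id', id_eq]
    by_cases hd : d = g.symm (((t.val - 1 : ℕ) : ZMod 3))
    · rw [if_pos hd, if_pos]
      rw [hd, Equiv.apply_symm_apply]
    · rw [if_neg hd, if_neg]
      intro h'
      exact hd (by rw [← h', Equiv.symm_apply_apply])

/-! ## §3 MERGING two adjacent players (qa-qnc0-p1 g18 ROUND-17 §2; `mergeTab` verbatim) -/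

/-- Merge players `0,1` of an `(m+2)`-block profile into ONE coarse player, for a fixed value `g` of the fine
transport `π₀` (which, given the coarse transport `Π = π₁ π₀`, is a uniform PRIVATE COIN independent of all hidden
data): the coarse player sees `Π` and plays `τ₀(g) · (τ₁(Π g⁻¹) ∘ g) ∈ V₄`; coarse player `b+1` is fine player `b+2`. -/
def mergeTab {m : ℕ} (g : Equiv.Perm (ZMod 3)) (τ : Fin (m + 2) → Equiv.Perm (ZMod 3) → Fin 4) :
    Fin (m + 1) → Equiv.Perm (ZMod 3) → Fin 4 :=
  fun b => if b = 0 then (fun P => mulTest (τ 0 g) (transportTest g (τ 1 (P * g⁻¹)))) else τ b.succ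

variable {m : ℕ}

/-- the merged (coarse) player `0`. -/
theorem mergeTab_zero (g : Equiv.Perm (ZMod 3)) (τ : Fin (m + 2) → Equiv.Perm (ZMod 3) → Fin 4)
    (P : Equiv.Perm (ZMod 3)) : mergeTab g τ 0 P = mulTest (τ 0 g) (transportTest g (τ 1 (P * g⁻¹))) := by
  simp [mergeTab]

/-- coarse player `i+1` is fine player `i+2`. -/
theorem mergeTab_succ (g : Equiv.Perm (ZMod 3)) (τ : Fin (m + 2) → Equiv.Perm (ZMod 3) → Fin 4)
    (i : Fin m) : mergeTab g τ i.succ = τ i.succ.succ := by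
  simp [mergeTab, Fin.succ_ne_zero]

/-! ### §3a The outcome bijection: merge (fine → coarse) and split (coarse + private coin → fine) -/

/-- coarse residues: coarse block `0` keeps `d 0`, coarse block `i+1` is fine block `i+2`. -/
def mergeD (d : Fin (m + 2) → ZMod 3) : Fin (m + 1) → ZMod 3 :=
  Fin.cons (d 0) fun i => d i.succ.succ

/-- coarse transports: coarse block `0` carries the composite `π₁ π₀`, coarse block `i+1` is fine block `i+2`. -/
def mergeP (π : Fin (m + 2) → Equiv.Perm (ZMod 3)) : Fin (m + 1) → Equiv.Perm (ZMod 3) :=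
  Fin.cons (π 1 * π 0) fun i => π i.succ.succ

/-- fine residues from coarse ones and the private coin `g = π₀`: `(d' 0, g (d' 0), d' 1, d' 2, …)`. -/
def splitD (g : Equiv.Perm (ZMod 3)) (d' : Fin (m + 1) → ZMod 3) : Fin (m + 2) → ZMod 3 :=
  Fin.cons (d' 0) (Fin.cons (g (d' 0)) fun i => d' i.succ)

/-- fine transports from coarse ones and the private coin `g = π₀`: `(g, Π₀ g⁻¹, Π₁, Π₂, …)`. -/
def splitP (g : Equiv.Perm (ZMod 3)) (π' : Fin (m + 1) → Equiv.Perm (ZMod 3)) :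
    Fin (m + 2) → Equiv.Perm (ZMod 3) :=
  Fin.cons g (Fin.cons (π' 0 * g⁻¹) fun i => π' i.succ)

/-- `mergeD d 0 = d 0`. -/
@[simp] theorem mergeD_zero (d : Fin (m + 2) → ZMod 3) : mergeD d 0 = d 0 := rfl
/-- `mergeD d (i+1) = d (i+2)`. -/
@[simp] theorem mergeD_succ (d : Fin (m + 2) → ZMod 3) (i : Fin m) : mergeD d i.succ = d i.succ.succ := by
  simp [mergeD]
/-- `mergeP π 0 = π 1 * π 0`. -/
@[simp] theorem mergeP_zero (π : Fin (m + 2) → Equiv.Perm (ZMod 3)) : mergeP π 0 = π 1 * π 0 := rfl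
/-- `mergeP π (i+1) = π (i+2)`. -/
@[simp] theorem mergeP_succ (π : Fin (m + 2) → Equiv.Perm (ZMod 3)) (i : Fin m) :
    mergeP π i.succ = π i.succ.succ := by simp [mergeP]
/-- `splitD g d' 0 = d' 0`. -/
@[simp] theorem splitD_zero (g : Equiv.Perm (ZMod 3)) (d' : Fin (m + 1) → ZMod 3) : splitD g d' 0 = d' 0 := rfl
/-- `splitD g d' 1 = g (d' 0)`. -/
@[simp] theorem splitD_one (g : Equiv.Perm (ZMod 3)) (d' : Fin (m + 1) → ZMod 3) : splitD g d' 1 = g (d' 0) := by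
  rw [← Fin.succ_zero_eq_one]; simp [splitD]
/-- `splitD g d' (i+2) = d' (i+1)`. -/
@[simp] theorem splitD_succ_succ (g : Equiv.Perm (ZMod 3)) (d' : Fin (m + 1) → ZMod 3) (i : Fin m) :
    splitD g d' i.succ.succ = d' i.succ := by simp [splitD]
/-- `splitP g π' 0 = g`. -/
@[simp] theorem splitP_zero (g : Equiv.Perm (ZMod 3)) (π' : Fin (m + 1) → Equiv.Perm (ZMod 3)) :
    splitP g π' 0 = g := rfl
/-- `splitP g π' 1 = π' 0 * g⁻¹`. -/
@[simp] theorem splitP_one (g : Equiv.Perm (ZMod 3)) (π' : Fin (m + 1) → Equiv.Perm (ZMod 3)) :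
    splitP g π' 1 = π' 0 * g⁻¹ := by rw [← Fin.succ_zero_eq_one]; simp [splitP]
/-- `splitP g π' (i+2) = π' (i+1)`. -/
@[simp] theorem splitP_succ_succ (g : Equiv.Perm (ZMod 3)) (π' : Fin (m + 1) → Equiv.Perm (ZMod 3))
    (i : Fin m) : splitP g π' i.succ.succ = π' i.succ := by simp [splitP]

/-- merge ∘ split = id on residues. -/
theorem mergeD_splitD (g : Equiv.Perm (ZMod 3)) (d' : Fin (m + 1) → ZMod 3) : mergeD (splitD g d') = d' := by
  funext b; cases b using Fin.cases <;> simp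

/-- merge ∘ split = id on transports. -/
theorem mergeP_splitP (g : Equiv.Perm (ZMod 3)) (π' : Fin (m + 1) → Equiv.Perm (ZMod 3)) :
    mergeP (splitP g π') = π' := by
  funext b; cases b using Fin.cases <;> simp

/-- split ∘ merge = id on residues of outcomes whose first link holds (`π₀ d₀ = d₁`). -/
theorem splitD_mergeD (d : Fin (m + 2) → ZMod 3) (π : Fin (m + 2) → Equiv.Perm (ZMod 3))
    (h01 : π 0 (d 0) = d 1) : splitD (π 0) (mergeD d) = d := by
  funext b
  cases b using Fin.cases with
  | zero => simp
  | succ c =>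
    cases c using Fin.cases with
    | zero => simpa using h01
    | succ i => simp

/-- split ∘ merge = id on transports. -/
theorem splitP_mergeP (π : Fin (m + 2) → Equiv.Perm (ZMod 3)) : splitP (π 0) (mergeP π) = π := by
  funext b
  cases b using Fin.cases with
  | zero => simp
  | succ c => cases c using Fin.cases <;> simp

/-! ### §3b Cyclic bookkeeping: the link condition `∀ b, P b (b+1)` on `Fin (n+1)` -/

/-- the cyclic condition `∀ b, P b (b+1)` splits into the `n` inner links `castSucc i → succ i` and the wrap
`last n → 0`. -/
theorem forall_link_iff {n : ℕ} (P : Fin (n + 1) → Fin (n + 1) → Prop) :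
    (∀ b, P b (b + 1)) ↔ (∀ i : Fin n, P i.castSucc i.succ) ∧ P (Fin.last n) 0 := by
  constructor
  · intro h
    refine ⟨fun i => ?_, ?_⟩
    · have := h i.castSucc
      rwa [Fin.coeSucc_eq_succ] at this
    · have := h (Fin.last n)
      rwa [Fin.last_add_one] at this
  · rintro ⟨h1, h2⟩ b
    cases b using Fin.lastCases with
    | last => rwa [Fin.last_add_one]
    | cast i => rw [Fin.coeSucc_eq_succ]; exact h1 i

/-- admissibility survives merging. -/
theorem valid_merge (d : Fin (m + 2) → ZMod 3) (π : Fin (m + 2) → Equiv.Perm (ZMod 3))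
    (h : Valid (m + 2) d π) : Valid (m + 1) (mergeD d) (mergeP π) := by
  obtain ⟨hlink, hsign⟩ := h
  obtain ⟨hF, hW⟩ := (forall_link_iff (fun b b' => π b (d b) = d b')).mp hlink
  have h01 : π 0 (d 0) = d 1 := by simpa using hF 0
  refine ⟨?_, ?_⟩
  · refine (forall_link_iff (fun b b' => mergeP π b (mergeD d b) = mergeD d b')).mpr ⟨fun i => ?_, ?_⟩
    · -- inner coarse link `i.castSucc → i.succ`
      rw [mergeD_succ]
      have hi := hF i.succ
      rw [← Fin.succ_castSucc] at hi
      rcases Fin.eq_zero_or_eq_succ i.castSucc with h0 | ⟨j, hj⟩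
      · rw [h0] at hi ⊢
        rw [mergeP_zero, mergeD_zero, Equiv.Perm.mul_apply, h01]
        simpa using hi
      · rw [hj] at hi ⊢
        rw [mergeP_succ, mergeD_succ]
        exact hi
    · -- the wrap `last m → 0`
      rw [mergeD_zero]
      have hl : Fin.last (m + 1) = (Fin.last m).succ := Fin.succ_last m |>.symm
      rw [hl] at hW
      rcases Fin.eq_zero_or_eq_succ (Fin.last m) with h0 | ⟨j, hj⟩
      · rw [h0] at hW ⊢
        rw [mergeP_zero, mergeD_zero, Equiv.Perm.mul_apply, h01]
        simpa using hW
      · rw [hj] at hW ⊢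
        rw [mergeP_succ, mergeD_succ]
        exact hW
  · rw [Fin.prod_univ_succ, Fin.prod_univ_succ] at hsign
    rw [Fin.prod_univ_succ, ← hsign]
    simp only [mergeP_zero, mergeP_succ, map_mul, Fin.succ_zero_eq_one]
    rw [mul_comm (Equiv.Perm.sign (π 1)) (Equiv.Perm.sign (π 0)), mul_assoc]

/-- admissibility survives splitting. -/
theorem valid_split (g : Equiv.Perm (ZMod 3)) (d' : Fin (m + 1) → ZMod 3)
    (π' : Fin (m + 1) → Equiv.Perm (ZMod 3)) (h : Valid (m + 1) d' π') :
    Valid (m + 2) (splitD g d') (splitP g π') := by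
  obtain ⟨hlink, hsign⟩ := h
  obtain ⟨hC, hW⟩ := (forall_link_iff (fun b b' => π' b (d' b) = d' b')).mp hlink
  refine ⟨?_, ?_⟩
  · refine (forall_link_iff (fun b b' => splitP g π' b (splitD g d' b) = splitD g d' b')).mpr ⟨fun c => ?_, ?_⟩
    · -- inner fine links: `c = 0` (the new link `g (d'0)`), `c = i.succ` (a coarse link)
      cases c using Fin.cases with
      | zero => simp
      | succ i =>
        rw [← Fin.succ_castSucc, splitD_succ_succ]
        have hi := hC i
        rcases Fin.eq_zero_or_eq_succ i.castSucc with h0 | ⟨j, hj⟩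
        · rw [h0] at hi ⊢
          rw [Fin.succ_zero_eq_one, splitP_one, splitD_one, Equiv.Perm.mul_apply]
          simpa using hi
        · rw [hj] at hi ⊢
          rw [splitP_succ_succ, splitD_succ_succ]
          simpa using hi
    · -- the wrap `last (m+1) → 0`
      rw [splitD_zero, ← Fin.succ_last]
      rcases Fin.eq_zero_or_eq_succ (Fin.last m) with h0 | ⟨j, hj⟩
      · rw [h0] at hW ⊢
        rw [Fin.succ_zero_eq_one, splitP_one, splitD_one, Equiv.Perm.mul_apply]
        simpa using hW
      · rw [hj] at hW ⊢
        rw [splitP_succ_succ, splitD_succ_succ]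
        simpa using hW
  · rw [Fin.prod_univ_succ] at hsign
    rw [Fin.prod_univ_succ, Fin.prod_univ_succ, ← hsign]
    simp only [splitP_zero, splitP_succ_succ]
    simp only [splitP, Fin.cons_succ, Fin.cons_zero, map_mul, map_inv]
    rw [mul_comm (Equiv.Perm.sign (π' 0)) _, ← mul_assoc, ← mul_assoc, mul_inv_cancel, one_mul]

/-- the merged table reproduces the fine payoff (product law + transport law at block `0`). -/
theorem payoff_merge (τ : Fin (m + 2) → Equiv.Perm (ZMod 3) → Fin 4) (d : Fin (m + 2) → ZMod 3)
    (π : Fin (m + 2) → Equiv.Perm (ZMod 3)) (h01 : π 0 (d 0) = d 1) :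
    payoff (m + 1) (mergeTab (π 0) τ) (mergeD d) (mergeP π) = payoff (m + 2) τ d π := by
  unfold payoff
  rw [Fin.prod_univ_succ, Fin.prod_univ_succ (n := m + 1), Fin.prod_univ_succ (n := m)]
  simp only [mergeTab_zero, mergeTab_succ, mergeP_zero, mergeP_succ, mergeD_zero, mergeD_succ,
    mul_inv_cancel_right, testVal_mulTest, testVal_transportTest, h01, Fin.succ_zero_eq_one]
  ring

/-! ### §3c Counting over a product, fibrewise -/

/-- `#{(a, b) | P a b} = ∑_a #{b | P a b}`. -/
theorem card_filter_prod_eq_sum {α β : Type*} [Fintype α] [Fintype β] (P : α → β → Prop)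
    [∀ a, DecidablePred (P a)] :
    (univ.filter fun x : α × β => P x.1 x.2).card = ∑ a, (univ.filter fun b => P a b).card := by
  rw [Finset.card_filter, Fintype.sum_prod_type]
  simp only [Finset.card_filter]

/-! ## §4 The MERGING IDENTITY and its consequences -/

/-- **The merging identity** (qa-qnc0-p1 g18 ROUND-17 §2, was STUB): the fine win-count is the SUM over the private
coin `g = π₀` of the coarse win-counts of the merged profiles.  Bijection `(d, π) ↦ (π 0; mergeD d, mergeP π)` between
admissible `(m+2)`-block outcomes and pairs (coin, admissible `(m+1)`-block outcome), inverse `splitD`/`splitP`;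
the payoff is carried by `payoff_merge`. -/
theorem wins_succ_eq_sum_merge (m : ℕ) (τ : Fin (m + 2) → Equiv.Perm (ZMod 3) → Fin 4) :
    wins (m + 2) τ = ∑ g : Equiv.Perm (ZMod 3), wins (m + 1) (mergeTab g τ) := by
  unfold wins
  rw [← card_filter_prod_eq_sum (fun (g : Equiv.Perm (ZMod 3))
      (o : (Fin (m + 1) → ZMod 3) × (Fin (m + 1) → Equiv.Perm (ZMod 3))) =>
        Valid (m + 1) o.1 o.2 ∧ payoff (m + 1) (mergeTab g τ) o.1 o.2 = -1)]
  refine Finset.card_nbij' (fun o => (o.2 0, (mergeD o.1, mergeP o.2)))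
    (fun x => (splitD x.1 x.2.1, splitP x.1 x.2.2)) ?_ ?_ ?_ ?_
  · -- maps admissible winners to admissible winners
    rintro ⟨d, π⟩ ho
    simp only [coe_filter, mem_univ, true_and, Set.mem_setOf_eq] at ho ⊢
    have h01 : π 0 (d 0) = d 1 := by simpa using ho.1.1 0
    exact ⟨valid_merge d π ho.1, by rw [payoff_merge τ d π h01]; exact ho.2⟩
  · rintro ⟨g, d', π'⟩ hx
    simp only [coe_filter, mem_univ, true_and, Set.mem_setOf_eq] at hx ⊢
    refine ⟨valid_split g d' π' hx.1, ?_⟩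
    have h := payoff_merge τ (splitD g d') (splitP g π') (by simp)
    rw [splitP_zero, mergeD_splitD, mergeP_splitP] at h
    rw [← h]; exact hx.2
  · rintro ⟨d, π⟩ ho
    simp only [coe_filter, mem_univ, true_and, Set.mem_setOf_eq] at ho
    have h01 : π 0 (d 0) = d 1 := by simpa using ho.1.1 0
    simp [splitD_mergeD d π h01, splitP_mergeP]
  · rintro ⟨g, d', π'⟩ _
    simp [mergeD_splitD, mergeP_splitP]

/-- **Counting** (was STUB): `total (m+2) = 6 · total (m+1)` — the same bijection with the payoff dropped
(so `total m = 3^m · 2^(m-1)` by induction from `total 1 = 3`). -/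
theorem total_succ (m : ℕ) : total (m + 2) = 6 * total (m + 1) := by
  have h6 : (6 : ℕ) = Fintype.card (Equiv.Perm (ZMod 3)) := by
    rw [Fintype.card_perm, ZMod.card]; rfl
  rw [h6, ← smul_eq_mul, ← Finset.card_univ, ← Finset.sum_const]
  unfold total
  rw [← card_filter_prod_eq_sum (fun (_ : Equiv.Perm (ZMod 3))
      (o : (Fin (m + 1) → ZMod 3) × (Fin (m + 1) → Equiv.Perm (ZMod 3))) => Valid (m + 1) o.1 o.2)]
  refine Finset.card_nbij' (fun o => (o.2 0, (mergeD o.1, mergeP o.2)))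
    (fun x => (splitD x.1 x.2.1, splitP x.1 x.2.2)) ?_ ?_ ?_ ?_
  · rintro ⟨d, π⟩ ho
    simp only [coe_filter, mem_univ, true_and, Set.mem_setOf_eq] at ho ⊢
    exact valid_merge d π ho
  · rintro ⟨g, d', π'⟩ hx
    simp only [coe_filter, mem_univ, true_and, Set.mem_setOf_eq] at hx ⊢
    exact valid_split g d' π' hx
  · rintro ⟨d, π⟩ ho
    simp only [coe_filter, mem_univ, true_and, Set.mem_setOf_eq] at ho
    have h01 : π 0 (d 0) = d 1 := by simpa using ho.1 0
    simp [splitD_mergeD d π h01, splitP_mergeP]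
  · rintro ⟨g, d', π'⟩ _
    simp [mergeD_splitD, mergeP_splitP]

/-- **MONOTONICITY** `V_{m+2} ≤ V_{m+1}`: the two-thirds law climbs from `m+1` to `m+2` blocks (splitting a
player into two players with finer views and no shared coin can only lower the team's value). -/
theorem blockGameTwoThirds_succ (m : ℕ) (h : BlockGameTwoThirds (m + 1)) : BlockGameTwoThirds (m + 2) := by
  intro τ
  rw [wins_succ_eq_sum_merge, total_succ]
  have hg : ∀ g : Equiv.Perm (ZMod 3), 3 * wins (m + 1) (mergeTab g τ) ≤ 2 * total (m + 1) := fun g => h _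
  calc 3 * ∑ g : Equiv.Perm (ZMod 3), wins (m + 1) (mergeTab g τ)
      = ∑ g : Equiv.Perm (ZMod 3), 3 * wins (m + 1) (mergeTab g τ) := by rw [Finset.mul_sum]
    _ ≤ ∑ _g : Equiv.Perm (ZMod 3), 2 * total (m + 1) := Finset.sum_le_sum fun g _ => hg g
    _ = 2 * (6 * total (m + 1)) := by
        rw [Finset.sum_const, Finset.card_univ, Fintype.card_perm, ZMod.card, smul_eq_mul]
        simp only [Nat.factorial, Nat.succ_eq_add_one, Nat.reduceAdd, Nat.reduceMul]
        ring

/-- **CONJECTURE F ⇐ its `m = 4` instance** (kit j291830/j292729: `V₄ = 432/648 = 2/3` exactly). -/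
theorem conjectureF'_of_four (h4 : BlockGameTwoThirds 4) : ConjectureF' := by
  intro k
  induction k with
  | zero => exact h4
  | succ k ih => exact blockGameTwoThirds_succ (k + 3) ih

/-- CONJECTURE F (the planner's `NeZero`-packaged form) from its `m = 4` instance. -/
theorem conjectureF_of_four (h4 : BlockGameTwoThirds 4) : ConjectureF := by
  intro m hm
  obtain ⟨k, rfl⟩ : ∃ k, m = k + 4 := ⟨m - 4, by omega⟩
  exact conjectureF'_of_four h4 k

end Summit.QuantumAdvantage.AdviceFreeQNC0.BlockGame
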